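import Summits.CriticalPhenomena.CardyFormulaZ2.Theorems.CardyComplexConeParafermionToSLESixFamiliesFaceKernelPercFaceK1
import HarnessLib

/-!
# The uniformizers of the oriented face domains of a bond-percolation discretisation family converge

Route `CardyComplexCone` (sub-problem `CriticalPhenomena/CardyFormulaZ2`), crux
`Summit.CriticalPhenomena.CardyFormulaZ2.Theses.CardyComplexCone.ParafermionToSLESixFamilies`
(item stmt-CriticalPhenomena-11389), line `face-kernel-k1` (lead c4).

With the kernel inputs (K1) (`percFaceK1`, this line) and (ULC) (`hlc_orientedFaceDomain`) both
proved, Pommerenke's kernel theorem for a GIVEN chordal uniformizing map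
(`MarkedDomain.exists_uniformizers_of_kernel_of_isChordalUniformizing`, fed with (B), (K2) and
`a_k → a`, `b_k → b` of `BondInterfaceFaceDomain.lean`) yields, unconditionally, chordal
uniformizing maps `φ_k` of the oriented polygonal face domains `(D_k; a_k, b_k)` of every
discretisation family of a Dobrushin domain `(D; a, b)` along positive admissible meshes `δ_k → 0`
whose boundary extensions converge to that of `φ` — uniformly on the closed half-plane (U0), on its
compacts (U1), and uniformly small at infinity towards `b_k` (U2): the deterministic half of the
hypotheses of `ae_isLoewnerDescribable_and_tendstoInDistribution_drivingPath_varying` (KS Cor. 1.8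
/ CDHKS 2014 §3 "`φ^δ → φ`") for bond percolation on `ℤ²`, now a theorem of the tree.
-/

noncomputable section

open scoped Topology
open Filter Set Metric
open UpperHalfPlane (upperHalfPlaneSet)
open Literature.Probability Literature.Probability.LatticeModels Literature.Probability.Percolation
open Literature.Probability.RandomPlanarGeometry
open Summit.CriticalPhenomena.CardyFormulaZ2.Cruxes.ParafermionToSLESixFamilies.CaratheodoryNetSlitUniformity

namespace Summit.CriticalPhenomena.CardyFormulaZ2.Cruxes.ParafermionToSLESixFamilies.FaceKernel

/-- **Convergent chordal uniformizers of the oriented face domains** (unconditional). For every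
Dobrushin domain `(D; a, b)`, discretisation family `Λ`, chordal uniformizing map `φ` of `D` and
positive admissible meshes `δ_k → 0`, there are chordal uniformizing maps `φ_k` of the oriented
face domains of `Λ δ_k` whose boundary extensions converge to that of `φ` uniformly on the closed
upper half-plane, uniformly on its compacts, and are uniformly close to `b_k` at infinity. -/
theorem exists_uniformizers_orientedFaceDomain :
    ∀ (D : DobrushinDomain) (Λ : ℝ → DiscreteDobrushin) (hΛ : ZdDiscretisationFamily D Λ)
      (φ : ConformalEquiv upperHalfPlaneSet D.carrier), D.IsChordalUniformizing φ →
      ∀ (δs : ℕ → ℝ), (∀ k, 0 < δs k) → Tendsto δs atTop (𝓝 0) →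
      ∀ (hadm : ∀ k, (Λ (δs k)).IsZdAdmissible),
      ∃ φs : ∀ k, ConformalEquiv upperHalfPlaneSet (orientedFaceDomain hΛ (hadm k)).carrier,
        (∀ k, (orientedFaceDomain hΛ (hadm k)).IsChordalUniformizing (φs k)) ∧
        TendstoUniformlyOn (fun k ↦ (φs k).boundaryExtension) φ.boundaryExtension atTop
          {z : ℂ | 0 ≤ z.im} ∧
        (∀ R : ℝ, TendstoUniformlyOn (fun k ↦ (φs k).boundaryExtension) φ.boundaryExtension
          atTop ({z : ℂ | 0 ≤ z.im} ∩ closedBall 0 R)) ∧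
        ∀ ε : ℝ, 0 < ε → ∃ r : ℝ, ∀ᶠ k in atTop, ∀ z : ℂ, z ∈ {z : ℂ | 0 ≤ z.im} → r ≤ ‖z‖ →
          dist ((φs k).boundaryExtension z) ((orientedFaceDomain hΛ (hadm k)).pt 1) ≤ ε := by
  intro D Λ hΛ φ hφ δs hpos hlim hadm
  set Ds : ℕ → DobrushinDomain := fun k ↦ orientedFaceDomain hΛ (hadm k) with hDs
  obtain ⟨hK1, hlc⟩ := percFaceKernel D Λ hΛ δs hpos hlim hadm
  obtain ⟨R, hR, hB⟩ := exists_forall_orientedFaceDomain_subset_ball hΛ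
  have hB' : ∃ R > 0, ∀ᶠ k in atTop, (Ds k).carrier ⊆ ball 0 R :=
    ⟨R, hR, Eventually.of_forall fun k ↦ hB (hadm k)⟩
  have hK2 : ∀ w ∉ D.carrier, ∀ r : ℝ, 0 < r → ∀ᶠ k in atTop, ¬ ball w r ⊆ (Ds k).carrier :=
    fun w hw r hr ↦ Eventually.of_forall fun k ↦ not_ball_subset_orientedFaceDomain hΛ (hadm k) hw hr
  obtain ⟨ha, hb⟩ := tendsto_pt_orientedFaceDomain hΛ hpos hlim hadm
  exact MarkedDomain.exists_uniformizers_of_kernel_of_isChordalUniformizing (Ds := Ds) hB' hK1 hK2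
    hlc ha hb φ hφ

end Summit.CriticalPhenomena.CardyFormulaZ2.Cruxes.ParafermionToSLESixFamilies.FaceKernel

end
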